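import Summits.AtomisticToContinuum.FouriersLaw.Theses.CageBudgetFekete
import Summits.AtomisticToContinuum.FouriersLaw.Theorems.EmbeddedDrudeMourreAbelThermodynamicLimitRegularDLRUnique
import Summits.AtomisticToContinuum.FouriersLaw.Theorems.EmbeddedDrudeMourreGreenKuboContinuationCurrentVariancePos
import Literature.MathematicalPhysics.KineticTheory.InfiniteChainSuperstableReversal
import Literature.MathematicalPhysics.KineticTheory.InfiniteChainPartialMomentumReversal
import Literature.MathematicalPhysics.KineticTheory.InfiniteChainCurrentMoments
import Literature.MathematicalPhysics.KineticTheory.InfiniteChainGibbsExistenceShift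
import Literature.MathematicalPhysics.KineticTheory.InfiniteChainStaticCurrentVariance

/-!
# `CageBudgetFekete.HeatVarianceCeiling` / Negative (1): what the cheap attacks establish

Support file (`--supports stmt-AtomisticToContinuum-15770`) written by the crux disprover of
`Summit.AtomisticToContinuum.FouriersLaw.Theses.CageBudgetFekete.HeatVarianceCeiling` (C: in the
guarded arena of route CageBudgetFekete the equilibrium heat variance
`V(τ) = 2∫_{(0,τ]} (τ-s) C(s) ds` of the infinite pinned quartic chain is eventually `≤ Bτ`). The
crux is NOT refuted — it is the finiteness half of Fourier's law for the CLOSED infinite chain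
(`ρ_J([-ε,ε]) = O(ε)` for the current spectral measure), an open problem whose only admissible
instances are genuine Newtonian flows in genuine DLR states; this file lands what the degenerate-
witness and envelope attacks establish WITH CERTAINTY (mirror image of the sibling file
`Theorems/UnboundedHeatVariance/Negative/LoadBearing.lean` for crux U, where the signs are
opposite: U is killed by TOO LITTLE current, C only by TOO MUCH).

* `exists_frozen_identity_dynamics` — for ANY chain and ANY measure with integrable / summable
  static current products, the structure `⟨∅, fun _ σ => σ, …⟩` (empty carrier, frozen flow) is
  an `InfiniteChainDynamics` whose every `flow t` preserves the measure, commutes with the shift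
  EVERYWHERE, has absolutely convergent correlations, and whose summed correlation is the CONSTANT
  `c₀ = ∑ₓ ∫ j₀ jₓ dμ` (so `C` is continuous and `V(τ) = c₀ τ²`).
* `tsum_integral_bondCurrentZ_mul_pos` — the static summed current covariance of a shift-invariant
  superstable DLR state is STRICTLY positive, `0 < c₀ = (T/4)∫(V'(r₀)+V'(r₁))² dμ`, for any chain
  with `U ≥ 0` continuous, `V` an even polynomial with odd-injective `V'` (dynamics-free form of
  `GreenKuboContinuation.TemperatureBlindVitaliHurwitz.currentCorrelation_zero_pos`, which asks for
  a `μ`-preserving dynamics only to replace `φ₀` by `id`).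
* `heatVarianceCeiling_false_without_carrierAE` — C with the a.e.-carrier clause of
  `D.PreservesMeasure μ` deleted (keeping measure preservation of every `flow t`, shift covariance,
  absolute convergence, continuity, the DLR state with all its symmetries) is FALSE: at
  `ω₂ = lam = β = γ = T = 1`, in the landed shift-invariant superstable DLR state (reversal
  invariant by DLR uniqueness in the regular class), the frozen identity flow has `C ≡ c₀ > 0`,
  `V(τ) = c₀τ²`, and no `B` works. So ANY proof of C must USE that `μ`-a.e. orbit of `D` solves
  Newton's equations — the ballistic shape `C ≡ C(0)` (the harmonic delimiter's shape,
  `Literature.Barriers.AtomisticToContinuum.HarmonicCrystalBallistic`) is compatible with every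
  other hypothesis of the arena.
* `heatVarianceCeiling_not_from_decaying_memory` — the natural strengthening "the ceiling follows
  from the frame" is FALSE as an implication schema: a continuous, non-negative memory bounded by
  its value at `0`, monotonically decaying to `0` on `[0,∞)` (everything `HeatVarianceCalculus`,
  `|C_T| ≤ C_T(0)` and qualitative mixing of the current give) can have superlinear heat variance
  (`C(t) = (1+|t|)^{-1/2}`, `V(τ) ≥ τ²/√(1+τ)`). A proof must produce the QUANTITATIVE statement
  "bounded Fejér means `∫₀^τ (1-s/τ) C_T(s) ds`", e.g. `C_T = O(t^{-a})`, `a > 1`, or cancellations.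

No new definitions; the weakened statements are spelled inline.
refuter-cdisprove-stmt-AtomisticToContinuum-15770-0, 2026-08-17.
-/

noncomputable section

namespace Summit.AtomisticToContinuum.FouriersLaw.Theorems.HeatVarianceCeiling.Negative

open MeasureTheory Filter Set Topology
open Literature.MathematicalPhysics.KineticTheory.HeatConduction
open Summit.AtomisticToContinuum.FouriersLaw.Theses

/-! ## §1 The frozen identity dynamics -/

/-- **Frozen identity dynamics.** For any chain `P` and measure `μ` under which the static products
`j₀ jₓ` are integrable with absolutely summable integrals, the structure with EMPTY carrier and the
time-independent identity flow is an `InfiniteChainDynamics P` (its four dynamical fields are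
vacuous); every `flow t` preserves `μ`, commutes with the shift, has absolutely convergent
correlations, and `C(t) = c₀ := ∑ₓ ∫ j₀ jₓ dμ` for every `t`. [folklore] -/
theorem exists_frozen_identity_dynamics (P : OscillatorChain) (μ : Measure ChainConfig)
    (hint : ∀ x : ℤ, Integrable (fun σ => P.bondCurrentZ σ 0 * P.bondCurrentZ σ x) μ)
    (hsum : Summable fun x : ℤ => |∫ σ, P.bondCurrentZ σ 0 * P.bondCurrentZ σ x ∂μ|) :
    ∃ D : InfiniteChainDynamics P,
      (∀ t : ℝ, MeasurePreserving (D.flow t) μ μ) ∧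
      (∀ (t : ℝ) (σ : ChainConfig), D.flow t (shift σ) = shift (D.flow t σ)) ∧
      (∀ t : ℝ, D.HasAbsConvergentCorrelation μ t) ∧
      ∀ t : ℝ, D.currentCorrelation μ t = ∑' x : ℤ, ∫ σ, P.bondCurrentZ σ 0 * P.bondCurrentZ σ x ∂μ :=
  ⟨⟨∅, fun _ σ => σ, fun _ => mapsTo_empty _ _, fun _ h => (notMem_empty _ h).elim,
      fun _ h => (notMem_empty _ h).elim, fun _ hγ _ _ => (notMem_empty _ (hγ 0)).elim⟩,
    fun _ => MeasurePreserving.id μ, fun _ _ => rfl, fun _ => ⟨hint, hsum⟩, fun _ => rfl⟩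

/-- The heat variance of a CONSTANT memory `c₀` is the ballistic parabola `c₀ τ²` (`τ ≥ 0`).
[folklore] -/
theorem heatVariance_const (c₀ τ : ℝ) (hτ : 0 ≤ τ) :
    2 * ∫ s in Set.Ioc (0:ℝ) τ, (τ - s) * c₀ = c₀ * τ ^ 2 := by
  have hI : ∫ s in Ioc (0:ℝ) τ, (τ - s) * c₀ = τ ^ 2 / 2 * c₀ := by
    rw [← intervalIntegral.integral_of_le hτ, intervalIntegral.integral_mul_const]
    congr 1
    have h := intervalIntegral.integral_comp_sub_left (fun y : ℝ => y) τ (a := 0) (b := τ)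
    simp only [sub_self, sub_zero] at h
    rw [h, integral_id]
    ring
  rw [hI]
  ring

/-! ## §2 The static summed current covariance is strictly positive -/

/-- **Positivity of the static summed current covariance** (dynamics-free form of
`currentCorrelation_zero_pos`). For a chain with `U ≥ 0` continuous, `V` an even non-negative
polynomial of degree `2s₂ ≥ 2` with `V'(r) + V'(r') = 0 ⟹ r + r' = 0`, and a shift-invariant DLR
state `μ` at `T > 0` with the superstability estimate (2.3):
`0 < ∑ₓ ∫ j₀ jₓ dμ = (T/4) ∫ (V'(r₀) + V'(r₁))² dμ` — the integrand vanishes only on the `μ`-null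
event `{q₀ = q₂}`. [folklore] -/
theorem tsum_integral_bondCurrentZ_mul_pos {P : OscillatorChain} {s₂ : ℕ} (h₂ : 1 ≤ s₂)
    (hU0 : ∀ r, 0 ≤ P.U r) (hU : Continuous P.U) (hVp : OscillatorChain.IsEvenPolyOfDegree P.V s₂)
    (hVinj : ∀ r r' : ℝ, deriv P.V r + deriv P.V r' = 0 → r + r' = 0)
    {T : ℝ} (hT : 0 < T) {μ : Measure ChainConfig}
    (hμ : P.IsChainGibbsMeasure T μ) (hshift : IsShiftInvariant μ)
    (hss : P.HasSuperstabilityEstimate μ) :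
    0 < ∑' x : ℤ, ∫ σ, P.bondCurrentZ σ 0 * P.bondCurrentZ σ x ∂μ := by
  haveI : IsProbabilityMeasure μ := hμ.1
  have hV : Continuous P.V := hVp.continuous
  have hV0 : ∀ r, 0 ≤ P.V r := hVp.choose_spec.2.2
  obtain ⟨c, hc, ha, hb, hI⟩ :=
    GreenKuboContinuation.TemperatureBlindVitaliHurwitz.exists_moment_bounds_of_hasSuperstabilityEstimate
      h₂ hU0 hU.measurable hVp hss
  have hq : ∀ x : ℤ, Measurable fun σ : ChainConfig => (σ x).1 := fun x =>
    (measurable_pi_apply x).fst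
  have ham : Measurable fun σ : ChainConfig => deriv P.V ((σ 1).1 - (σ 0).1) :=
    (measurable_deriv P.V).comp ((hq 1).sub (hq 0))
  have hbm : Measurable fun σ : ChainConfig => deriv P.V ((σ 2).1 - (σ 1).1) :=
    (measurable_deriv P.V).comp ((hq 2).sub (hq 1))
  have hW0 : ∀ σ : ChainConfig, 0 ≤ P.bmLocalEnergy 0 2 σ := fun σ =>
    zero_le_one.trans (OscillatorChain.one_le_bmLocalEnergy hU0 hV0 0 2 σ)
  have e_a2 : ∀ σ : ChainConfig, |deriv P.V ((σ 1).1 - (σ 0).1) ^ 2| ≤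
      c ^ 2 * P.bmLocalEnergy 0 2 σ ^ 2 := fun σ => by
    rw [abs_pow, ← mul_pow]
    exact pow_le_pow_left₀ (abs_nonneg _) (ha σ) 2
  have e_ab : ∀ σ : ChainConfig,
      |deriv P.V ((σ 1).1 - (σ 0).1) * deriv P.V ((σ 2).1 - (σ 1).1)| ≤
      c ^ 2 * P.bmLocalEnergy 0 2 σ ^ 2 := fun σ => by
    rw [abs_mul]
    calc |deriv P.V ((σ 1).1 - (σ 0).1)| * |deriv P.V ((σ 2).1 - (σ 1).1)|
        ≤ (c * P.bmLocalEnergy 0 2 σ) * (c * P.bmLocalEnergy 0 2 σ) :=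
          mul_le_mul (ha σ) (hb σ) (abs_nonneg _) (mul_nonneg hc (hW0 σ))
      _ = c ^ 2 * P.bmLocalEnergy 0 2 σ ^ 2 := by ring
  have e_s2 : ∀ σ : ChainConfig,
      |(deriv P.V ((σ 1).1 - (σ 0).1) + deriv P.V ((σ 2).1 - (σ 1).1)) ^ 2| ≤
      (2 * c) ^ 2 * P.bmLocalEnergy 0 2 σ ^ 2 := fun σ => by
    rw [abs_pow, ← mul_pow]
    refine pow_le_pow_left₀ (abs_nonneg _) ((abs_add_le _ _).trans ?_) 2
    linarith [ha σ, hb σ]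
  obtain ⟨ha2, hIa2⟩ := hI (c ^ 2) (fun σ => deriv P.V ((σ 1).1 - (σ 0).1) ^ 2)
    (ham.pow_const 2) e_a2
  obtain ⟨hab, hIab⟩ := hI (c ^ 2)
    (fun σ => deriv P.V ((σ 1).1 - (σ 0).1) * deriv P.V ((σ 2).1 - (σ 1).1)) (ham.mul hbm) e_ab
  obtain ⟨hs2, -⟩ := hI ((2 * c) ^ 2)
    (fun σ => (deriv P.V ((σ 1).1 - (σ 0).1) + deriv P.V ((σ 2).1 - (σ 1).1)) ^ 2)
    ((ham.add hbm).pow_const 2) e_s2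
  rw [hμ.tsum_integral_bondCurrentZ_mul_eq hU hV hT hshift
    (fun i j h1 h2 h3 h4 => hIa2 i j (by omega) (by omega) (by omega) (by omega))
    (fun i j h1 h2 h3 h4 => hIab i j (by omega) h2 (by omega) h4) ha2 hab]
  refine mul_pos (by positivity) ?_
  rw [integral_pos_iff_support_of_nonneg_ae (Eventually.of_forall fun σ => sq_nonneg _) hs2]
  have hS : MeasurableSet {σ : ChainConfig | (σ 0).1 = (σ 2).1} :=
    measurableSet_eq_fun (hq 0) (hq 2)
  have hone : μ {σ : ChainConfig | (σ 0).1 = (σ 2).1}ᶜ = 1 :=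
    (prob_compl_eq_one_iff hS).2 (hμ.measure_fst_eq_fst (by norm_num))
  have hsub : {σ : ChainConfig | (σ 0).1 = (σ 2).1}ᶜ ⊆ Function.support fun σ : ChainConfig =>
      (deriv P.V ((σ 1).1 - (σ 0).1) + deriv P.V ((σ 2).1 - (σ 1).1)) ^ 2 := by
    intro σ hσ h0
    have h := hVinj _ _ ((pow_eq_zero_iff two_ne_zero).1 h0)
    exact hσ (by show (σ 0).1 = (σ 2).1; linarith)
  calc (0 : ENNReal) < 1 := one_pos
    _ = μ {σ : ChainConfig | (σ 0).1 = (σ 2).1}ᶜ := hone.symm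
    _ ≤ μ (Function.support fun σ : ChainConfig =>
        (deriv P.V ((σ 1).1 - (σ 0).1) + deriv P.V ((σ 2).1 - (σ 1).1)) ^ 2) := measure_mono hsub

/-- **Instance for the pinned chain.** For `pinnedChain ω₂ lam β γ` (`ω₂ > 0`, `lam, β ≥ 0`, any `γ`),
`T > 0` and a shift-invariant superstable DLR state `μ` at `T`: `0 < ∑ₓ ∫ j₀ jₓ dμ` — the frozen
memory constant of §1 is strictly positive (`V'(r) = r + βr³` is odd and injective). [folklore] -/
theorem tsum_integral_bondCurrentZ_mul_pos_pinnedChain {ω₂ lam β : ℝ} (γ : ℝ) (hω : 0 < ω₂)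
    (hl : 0 ≤ lam) (hβ : 0 < β) {T : ℝ} (hT : 0 < T) {μ : Measure ChainConfig}
    (hμ : (pinnedChain ω₂ lam β γ).IsChainGibbsMeasure T μ) (hshift : IsShiftInvariant μ)
    (hss : (pinnedChain ω₂ lam β γ).HasSuperstabilityEstimate μ) :
    0 < ∑' x : ℤ, ∫ σ, (pinnedChain ω₂ lam β γ).bondCurrentZ σ 0 *
      (pinnedChain ω₂ lam β γ).bondCurrentZ σ x ∂μ := by
  have hU : Continuous (pinnedChain ω₂ lam β γ).U := by
    show Continuous fun q : ℝ => ω₂ * q ^ 2 / 2 + lam * q ^ 4 / 4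
    fun_prop
  exact tsum_integral_bondCurrentZ_mul_pos one_le_two
    (OscillatorChain.pinnedChain_U_nonneg β γ hω.le hl) hU
    (OscillatorChain.pinnedChain_isEvenPolyOfDegree_V ω₂ lam γ hβ)
    (GreenKuboContinuation.TemperatureBlindVitaliHurwitz.pinnedChain_deriv_V_add_eq_zero γ hβ.le)
    hT hμ hshift hss

/-! ## §3 The a.e.-carrier clause is load-bearing -/

/-- **C without the a.e.-carrier clause is false.** Replace `D.PreservesMeasure μ` by its second
clause `∀ t, MeasurePreserving (D.flow t) μ μ` in `CageBudgetFekete.HeatVarianceCeiling`: the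
resulting statement fails at `ω₂ = lam = β = γ = 1`, `T = 1`, for the shift-invariant superstable
DLR state `μ` (unique in its class, hence momentum-reversal invariant) and the frozen identity
dynamics (carrier `∅`): `C ≡ c₀ = ∑ₓ ∫ j₀ jₓ dμ > 0`, `V(τ) = c₀ τ²`, which exceeds `Bτ` at
`τ = max(τ₁, 1, B/c₀ + 1)`. Any proof of the ceiling must therefore USE that `μ`-a.e. orbit of `D`
solves Newton's equations; measure preservation of the time-`t` maps and all the symmetries do not
exclude the ballistic shape `C ≡ C(0)`. [folklore] -/
theorem heatVarianceCeiling_false_without_carrierAE :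
    ¬ (∀ ω₂ lam β γ : ℝ, 0 < ω₂ → 0 < lam → 0 < β → ∀ T : ℝ, 0 < T →
        ∀ μ : MeasureTheory.Measure ChainConfig,
          (pinnedChain ω₂ lam β γ).IsChainGibbsMeasure T μ → IsShiftInvariant μ →
          μ.map (fun σ : ChainConfig => fun x : ℤ => ((σ x).1, -(σ x).2)) = μ →
          ∀ D : InfiniteChainDynamics (pinnedChain ω₂ lam β γ),
            (∀ t : ℝ, MeasurePreserving (D.flow t) μ μ) →
            (∀ t : ℝ, ∀ᵐ σ ∂μ, D.flow t (shift σ) = shift (D.flow t σ)) →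
            (∀ t : ℝ, D.HasAbsConvergentCorrelation μ t) →
            Continuous (fun t : ℝ => D.currentCorrelation μ t) →
            ∀ V : ℝ → ℝ, V = (fun τ : ℝ => 2 * ∫ s in Set.Ioc (0:ℝ) τ, (τ - s) * D.currentCorrelation μ s) →
              ∃ B τ₁ : ℝ, ∀ τ : ℝ, τ₁ ≤ τ → V τ ≤ B * τ) := by
  intro h
  set P := pinnedChain 1 1 1 1 with hP
  obtain ⟨μ, hG, hS, hss⟩ :=
    OscillatorChain.exists_isChainGibbsMeasure_shiftInvariant_superstable_pinnedChain (1:ℝ) one_pos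
      zero_le_one zero_le_one one_pos (ω₂ := 1) (lam := 1) (β := 1) (T := 1)
  -- reversal invariance from DLR uniqueness in the regular class (landed)
  have hR : μ.map momentumReversalZ = μ :=
    OscillatorChain.map_momentumReversalZ_eq_of_regular_unique hG hS hss
      (AbelThermodynamicLimit.LoomisCompactHorizonWitness.stub_regularDLRUnique
        1 1 1 1 one_pos one_pos one_pos one_pos 1 one_pos)
  -- static integrability / summability
  have hU0 : ∀ r, 0 ≤ P.U r := OscillatorChain.pinnedChain_U_nonneg 1 1 zero_le_one zero_le_one
  have hUm : Measurable P.U := OscillatorChain.measurable_pinnedChain_U 1 1 1 1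
  have hV := OscillatorChain.pinnedChain_isEvenPolyOfDegree_V (1:ℝ) (1:ℝ) (1:ℝ) (β := 1) one_pos
  have hint : ∀ x : ℤ, Integrable (fun σ => P.bondCurrentZ σ 0 * P.bondCurrentZ σ x) μ :=
    fun x => hss.integrable_bondCurrentZ_mul_comp one_le_two hU0 hUm hV (MeasurePreserving.id μ) x 0
  have hsum : Summable fun x : ℤ => |∫ σ, P.bondCurrentZ σ 0 * P.bondCurrentZ σ x ∂μ| :=
    hG.summable_abs_integral_bondCurrentZ_mul
  set c₀ : ℝ := ∑' x : ℤ, ∫ σ, P.bondCurrentZ σ 0 * P.bondCurrentZ σ x ∂μ with hc₀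
  have hc₀pos : 0 < c₀ :=
    tsum_integral_bondCurrentZ_mul_pos_pinnedChain (1:ℝ) one_pos zero_le_one one_pos one_pos hG hS hss
  -- the frozen identity dynamics: C ≡ c₀
  obtain ⟨D, hmp, hcov, hAC, hC⟩ := exists_frozen_identity_dynamics P μ hint hsum
  have hcont : Continuous (fun t : ℝ => D.currentCorrelation μ t) := by
    simp only [hC]; exact continuous_const
  obtain ⟨B, τ₁, hB⟩ := h 1 1 1 1 one_pos one_pos one_pos 1 one_pos μ hG hS hR D hmp
    (fun t => Eventually.of_forall (hcov t)) hAC hcont _ rfl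
  -- a large time where the parabola beats the line
  set τ : ℝ := max τ₁ (max 1 (B / c₀ + 1)) with hτ
  have hτ1 : 1 ≤ τ := le_trans (le_max_left _ _) (le_max_right _ _)
  have hτB : B / c₀ + 1 ≤ τ := le_trans (le_max_right _ _) (le_max_right _ _)
  have hτ0 : 0 < τ := by linarith
  have hVB := hB τ (le_max_left _ _)
  simp only [hC] at hVB
  rw [← hc₀, heatVariance_const c₀ τ hτ0.le] at hVB
  -- c₀ τ² ≤ B τ contradicts c₀ τ > B
  have h1 : c₀ * τ ≤ B := by
    have : (c₀ * τ) * τ ≤ B * τ := by nlinarith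
    exact le_of_mul_le_mul_right this hτ0
  have h2 : B < c₀ * τ := by
    have : B / c₀ + 1 ≤ τ := hτB
    have h3 : c₀ * (B / c₀ + 1) ≤ c₀ * τ := mul_le_mul_of_nonneg_left this hc₀pos.le
    rw [mul_add, mul_div_cancel₀ B hc₀pos.ne', mul_one] at h3
    linarith
  linarith

/-! ## §4 The frame does not give the ceiling: a decaying memory with superlinear variance -/

/-- **The ceiling is not a property of continuous, bounded, monotonically decaying memories.**
The implication schema "`C` continuous, `0 ≤ C ≤ C(0)`, antitone on `[0,∞)`, `C(t) → 0`
⟹ `∃ B τ₁, ∀ τ ≥ τ₁, 2∫_{(0,τ]}(τ-s)C(s)ds ≤ Bτ`" is FALSE: `C(t) = (1+|t|)^{-1/2}` has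
`V(τ) ≥ τ²/√(1+τ)`, superlinear. Hence no proof of `HeatVarianceCeiling` can close from the frame
(`HeatVarianceCalculus`: regularity, `V ≥ 0`, Laplace identity), the Cauchy–Schwarz bound
`|C_T| ≤ C_T(0)` and qualitative mixing of the current alone: it must reach the quantitative
statement "bounded Fejér means `2∫₀^τ (1 - s/τ) C_T(s) ds`" (= `V(τ)/τ`), e.g. through a decay rate
`C_T = O(t^{-a})`, `a > 1`, or through sign cancellations. [folklore] -/
theorem heatVarianceCeiling_not_from_decaying_memory :
    ¬ (∀ C : ℝ → ℝ, Continuous C → (∀ t, 0 ≤ C t) → (∀ t, C t ≤ C 0) →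
        AntitoneOn C (Set.Ici 0) → Tendsto C atTop (𝓝 0) →
        ∀ V : ℝ → ℝ, V = (fun τ : ℝ => 2 * ∫ s in Set.Ioc (0:ℝ) τ, (τ - s) * C s) →
          ∃ B τ₁ : ℝ, ∀ τ : ℝ, τ₁ ≤ τ → V τ ≤ B * τ) := by
  intro h
  set C : ℝ → ℝ := fun t => (Real.sqrt (1 + |t|))⁻¹ with hC
  have hpos : ∀ t, 0 < Real.sqrt (1 + |t|) := fun t => Real.sqrt_pos.2 (by positivity)
  have hCc : Continuous C := Continuous.inv₀ (by fun_prop) fun t => (hpos t).ne'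
  have hC0 : ∀ t, 0 ≤ C t := fun t => inv_nonneg.2 (Real.sqrt_nonneg _)
  have hCle : ∀ s t, |s| ≤ |t| → C t ≤ C s := fun s t hst => by
    simp only [hC]
    exact inv_anti₀ (hpos s) (Real.sqrt_le_sqrt (by linarith))
  have hCmax : ∀ t, C t ≤ C 0 := fun t => hCle 0 t (by simp)
  have hanti : AntitoneOn C (Ici 0) := fun s hs t ht hst =>
    hCle s t (by rw [abs_of_nonneg (show (0:ℝ) ≤ s from hs), abs_of_nonneg (show (0:ℝ) ≤ t from ht)]; exact hst)
  have hlim : Tendsto C atTop (𝓝 0) :=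
    tendsto_inv_atTop_zero.comp (Real.tendsto_sqrt_atTop.comp
      (tendsto_atTop_add_const_left _ 1 tendsto_abs_atTop_atTop))
  obtain ⟨B, τ₁, hB⟩ := h C hCc hC0 hCmax hanti hlim _ rfl
  set τ : ℝ := max τ₁ (max 1 (2 * B ^ 2 + 1)) with hτ
  have hτ1 : 1 ≤ τ := le_trans (le_max_left _ _) (le_max_right _ _)
  have hτB : 2 * B ^ 2 + 1 ≤ τ := le_trans (le_max_right _ _) (le_max_right _ _)
  have hτ0 : 0 < τ := by linarith
  have hVB := hB τ (le_max_left _ _)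
  -- lower bound: V τ ≥ τ² C(τ) = τ²/√(1+τ)
  have hlow : τ ^ 2 / 2 * C τ ≤ ∫ s in Set.Ioc (0:ℝ) τ, (τ - s) * C s := by
    have hI : ∫ s in Ioc (0:ℝ) τ, (τ - s) * C τ = τ ^ 2 / 2 * C τ := by
      have := heatVariance_const (C τ) τ hτ0.le
      linarith
    rw [← hI]
    refine setIntegral_mono_on ((continuous_const.sub continuous_id).mul continuous_const).integrableOn_Ioc
      ((continuous_const.sub continuous_id).mul hCc).integrableOn_Ioc measurableSet_Ioc ?_
    intro s hs
    exact mul_le_mul_of_nonneg_left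
      (hCle s τ (by rw [abs_of_nonneg hs.1.le, abs_of_nonneg hτ0.le]; exact hs.2))
      (sub_nonneg.2 hs.2)
  have hV : τ ^ 2 * C τ ≤ B * τ := by linarith
  have hS : 0 < Real.sqrt (1 + |τ|) := hpos τ
  have hS2 : Real.sqrt (1 + |τ|) ^ 2 = 1 + τ := by
    rw [Real.sq_sqrt (by positivity), abs_of_nonneg hτ0.le]
  have h1 : τ ^ 2 ≤ B * τ * Real.sqrt (1 + |τ|) := by
    have := mul_le_mul_of_nonneg_right hV hS.le
    simp only [hC] at this
    rwa [mul_assoc, inv_mul_cancel₀ hS.ne', mul_one] at this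
  have h2 : τ ≤ B * Real.sqrt (1 + |τ|) := by
    have : τ * τ ≤ (B * Real.sqrt (1 + |τ|)) * τ := by nlinarith
    exact le_of_mul_le_mul_right this hτ0
  have hB0 : 0 ≤ B := by
    by_contra hB0
    have : B * Real.sqrt (1 + |τ|) < 0 := mul_neg_of_neg_of_pos (lt_of_not_ge hB0) hS
    linarith
  have h3 : τ ^ 2 ≤ B ^ 2 * (1 + τ) := by
    calc τ ^ 2 ≤ (B * Real.sqrt (1 + |τ|)) ^ 2 := pow_le_pow_left₀ hτ0.le h2 2
      _ = B ^ 2 * (1 + τ) := by rw [mul_pow, hS2]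
  nlinarith

end Summit.AtomisticToContinuum.FouriersLaw.Theorems.HeatVarianceCeiling.Negative

end
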